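import Mathlib
import Summits.NavierStokesRegularity.NavierStokesRegularity.Theorems.WakeRatchetTailRatchetRelayTransversality
import HarnessLib

/-!
# `WakeRatchet.TailRatchet` (stmt-NavierStokesRegularity-21808): GREEN'S IDENTITY for the linearised
# drain-free front operator against its adjoint mode, and the bordering direction is NOT in the range

Support file for the crux `TailRatchet` (route `WakeRatchet`; MODEL lattice ODEs of Tao 2016 §1.2, §4 —
nothing in this file is a statement about the Navier–Stokes equations, and no item is closed here).

Context (files `WakeRatchetTailRatchetRelayProfile` / `…RelayAdjoint` / `…RelayTransversality` /
`…RelayKernel`; census of stmt-21808, programme "R-lac"): `L₀h = h' − 2e^{t/2}h(t/2)` is the linearisation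
of the normalised drain-free scalar front equation of the construction item `DyadicScalarFronts` at the relay
profile `(b₀,s₀) = (e^{t},2)`; `w₁(t) = Σ_m c_m e^{(2^m−1)t}` (`c_m = ∏_{i<m}(−4)/(2^{i+1}−1)`) is its
adjoint mode (`w₁' = −4e^{t}w₁(2t)` on `t < 0`, `w₁(−∞) = 1`).  This file proves the duality between them
on the half-line `(−∞,0]`, sorry-free:

* `adjoint_continuousOn`, `adjoint_abs_le` — `w₁` is continuous on `(−∞,0]` and `|w₁| ≤ 71` there;
* `integral_dilate_Iic` — the dilation identity `∫_{(−∞,0]} g(2u) du = ½ ∫_{(−∞,0]} g`;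
* `adjoint_green` — **GREEN'S IDENTITY**: for `h` continuous and bounded on `(−∞,0]`, differentiable on
  `t < 0` with `h'` integrable, and `h(t) → L` as `t → −∞`,
  `∫_{(−∞,0]} w₁ · (h' − 2e^{t/2}h(t/2)) dt = w₁(0)·h(0) − L`
  (fundamental theorem on `(−∞,0]` for `w₁h`, the adjoint equation, and the dilation `u = t/2`, which on
  the full half-line produces no boundary term);
* `range_annihilated` — hence `∫ w₁ · L₀h = 0` for every such `h` with `h(0) = 0` and `h(−∞) = 0`: the
  range of `L₀` on the normalised decaying class lies in `ker(∫ w₁ ·)`;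
* `bordering_not_in_range` — **the bordering direction `(1+t/2)e^{t} = ∂_sG(b₀,·)|_{s=2}` is NOT of the
  form `L₀h`** for any such `h` (by `WakeRatchetRelayTransversality.transversality_ne_zero`): to first
  order the time ratio `s` MUST move when the drain `δ = Λ⁻²` is switched on — the implicit-function
  construction for lacunary `Λ` is genuinely a bordered problem in `(h, s)`.

Remaining for R-lac (census): the converse solvability `ker(∫w₁·) ⊆ range L₀` on weighted spaces (Picard
iteration for the backward pantograph problem) and the `C¹` setting; fronts for lacunary `Λ` do NOT refute
`TailRatchet` (which needs `Λ → 1`).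

HONEST FRAMING: elementary real analysis; MODEL lattice only; the construction item and the crux stay open.
-/

noncomputable section

set_option linter.dupNamespace false

namespace Summit.NavierStokesRegularity.NavierStokesRegularity.Theorems

namespace WakeRatchetRelayGreen

open MeasureTheory Set Filter Topology Real
open WakeRatchetRelayAdjoint WakeRatchetRelayTransversality

/-! ## The adjoint mode on the closed half-line: continuity and a uniform bound -/

/-- `w₁` is continuous on `(−∞,0]` (uniform convergence, Weierstrass M-test with `210·4^{−m}`). [folklore] -/
theorem adjoint_continuousOn :
    ContinuousOn (fun t : ℝ => ∑' m : ℕ,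
      (∏ i ∈ Finset.range m, ((-4 : ℝ) / (2 ^ (i + 1) - 1))) * Real.exp ((2 ^ m - 1) * t)) (Iic 0) := by
  refine continuousOn_tsum (fun m => ?_) summable_majorant (fun m t ht => term_abs_le m ht)
  exact (continuous_const.mul (Real.continuous_exp.comp (continuous_const.mul continuous_id))).continuousOn

/-- `|w₁(t)| ≤ 71` on `t ≤ 0`. [folklore] -/
theorem adjoint_abs_le {t : ℝ} (ht : t ≤ 0) :
    |∑' m : ℕ, (∏ i ∈ Finset.range m, ((-4 : ℝ) / (2 ^ (i + 1) - 1))) * Real.exp ((2 ^ m - 1) * t)| ≤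
      71 := by
  have h1 := adjoint_sub_one_abs_le ht
  have h2 : Real.exp t ≤ 1 := Real.exp_le_one_iff.2 ht
  have h3 := abs_sub_abs_le_abs_sub
    (∑' m : ℕ, (∏ i ∈ Finset.range m, ((-4 : ℝ) / (2 ^ (i + 1) - 1))) * Real.exp ((2 ^ m - 1) * t)) 1
  rw [abs_one] at h3
  linarith

/-! ## The dilation identity on the half-line -/

/-- **Dilation on `(−∞,0]`**: `∫_{(−∞,0]} g(2u) du = ½ ∫_{(−∞,0]} g(t) dt` (no boundary term: the dilation
maps the half-line onto itself). [folklore] -/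
theorem integral_dilate_Iic (g : ℝ → ℝ) :
    ∫ u in Iic (0 : ℝ), g (2 * u) = 1 / 2 * ∫ t in Iic (0 : ℝ), g t := by
  have h1 : (∫ u in Iic (0 : ℝ), g (2 * u)) = ∫ x in Ioi (0 : ℝ), g (2 * (-x)) := by
    rw [integral_comp_neg_Ioi 0 (fun u : ℝ => g (2 * u)), neg_zero]
  have h2 : (fun x : ℝ => g (2 * (-x))) = fun x : ℝ => (fun y : ℝ => g (-y)) (2 * x) := by
    funext x; simp only [mul_neg]
  have h3 : (∫ x in Ioi (0 : ℝ), (fun y : ℝ => g (-y)) (2 * x)) =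
      (2 : ℝ)⁻¹ • ∫ y in Ioi (2 * 0 : ℝ), (fun y : ℝ => g (-y)) y :=
    integral_comp_mul_left_Ioi (fun y : ℝ => g (-y)) 0 two_pos
  have h4 : (∫ y in Ioi (0 : ℝ), g (-y)) = ∫ t in Iic (0 : ℝ), g t := by
    rw [integral_comp_neg_Ioi 0 g, neg_zero]
  rw [h1, h2, h3, mul_zero, smul_eq_mul]
  simp only []
  rw [h4]
  ring

/-! ## Green's identity -/

/-- **GREEN'S IDENTITY for `L₀` against the adjoint mode.**  Let `w₁` be the adjoint mode (given as the
lacunary series) and let `h` be continuous and bounded on `(−∞,0]`, differentiable on `t < 0` with derivative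
`h'` integrable on `(−∞,0]`, and `h(t) → L` as `t → −∞`.  Then
`∫_{(−∞,0]} w₁(t) (h'(t) − 2e^{t/2} h(t/2)) dt = w₁(0) h(0) − L`.
[cite: Tao2016AveragedNS, §1.2 (dyadic model); cell vocabulary (linearisation of the scalar front equation of `DyadicScalarFronts` at the relay profile and its adjoint; programme R-lac)] -/
theorem adjoint_green (W : ℝ → ℝ)
    (hW : W = fun t : ℝ => ∑' m : ℕ,
      (∏ i ∈ Finset.range m, ((-4 : ℝ) / (2 ^ (i + 1) - 1))) * Real.exp ((2 ^ m - 1) * t))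
    {h h' : ℝ → ℝ} {B L : ℝ} (hcont : ContinuousOn h (Iic 0))
    (hde : ∀ t : ℝ, t < 0 → HasDerivAt h (h' t) t) (hbd : ∀ t : ℝ, t ≤ 0 → |h t| ≤ B)
    (hint : IntegrableOn h' (Iic 0)) (hlim : Tendsto h atBot (𝓝 L)) :
    ∫ t in Iic (0 : ℝ), W t * (h' t - 2 * Real.exp (t / 2) * h (t / 2)) = W 0 * h 0 - L := by
  have hB : 0 ≤ B := (abs_nonneg _).trans (hbd 0 le_rfl)
  -- properties of `W` on the half-line
  have hWcont : ContinuousOn W (Iic 0) := by rw [hW]; exact adjoint_continuousOn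
  have hWbd : ∀ t : ℝ, t ≤ 0 → |W t| ≤ 71 := by
    intro t ht; rw [hW]; exact adjoint_abs_le ht
  have hWde : ∀ t : ℝ, t < 0 → HasDerivAt W (-4 * Real.exp t * W (2 * t)) t := by
    intro t ht; rw [hW]; exact adjoint_hasDerivAt ht
  have hWlim : Tendsto W atBot (𝓝 1) := by rw [hW]; exact adjoint_tendsto_atBot
  -- continuity of the auxiliary functions on the half-line
  have hW2cont : ContinuousOn (fun t : ℝ => W (2 * t)) (Iic 0) :=
    hWcont.comp (continuous_const.mul continuous_id).continuousOn
      (fun t ht => by simp only [mem_Iic] at ht ⊢; linarith)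
  have hh2cont : ContinuousOn (fun t : ℝ => h (t / 2)) (Iic 0) :=
    hcont.comp (continuous_id.div_const 2).continuousOn
      (fun t ht => by simp only [mem_Iic] at ht ⊢; linarith)
  -- the product `φ = W·h`
  have hφde : ∀ t ∈ Iio (0 : ℝ), HasDerivAt (fun t => W t * h t)
      (-4 * Real.exp t * W (2 * t) * h t + W t * h' t) t :=
    fun t ht => (hWde t ht).mul (hde t ht)
  have hφcont : ContinuousWithinAt (fun t => W t * h t) (Iic 0) 0 :=
    (hWcont 0 self_mem_Iic).mul (hcont 0 self_mem_Iic)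
  have hφlim : Tendsto (fun t => W t * h t) atBot (𝓝 (1 * L)) := hWlim.mul hlim
  -- integrability of the two pieces of `φ'`
  have hI1 : IntegrableOn (fun t : ℝ => W t * h' t) (Iic 0) := by
    refine Integrable.bdd_mul (c := 71) hint (hWcont.aestronglyMeasurable measurableSet_Iic) ?_
    exact (ae_restrict_iff' measurableSet_Iic).2 (Eventually.of_forall fun t ht => by
      rw [Real.norm_eq_abs]; exact hWbd t ht)
  have hI2 : IntegrableOn (fun t : ℝ => -4 * Real.exp t * W (2 * t) * h t) (Iic 0) := by
    have hmaj : IntegrableOn (fun t : ℝ => 4 * 71 * B * Real.exp t) (Iic 0) :=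
      (integrableOn_exp_Iic 0).const_mul _
    refine Integrable.mono' hmaj ?_ ?_
    · exact (((continuous_const.mul Real.continuous_exp).continuousOn.mul hW2cont).mul hcont)
        |>.aestronglyMeasurable measurableSet_Iic
    · refine (ae_restrict_iff' measurableSet_Iic).2 (Eventually.of_forall fun t ht => ?_)
      have h2t : 2 * t ≤ 0 := by simp only [mem_Iic] at ht; linarith
      rw [Real.norm_eq_abs, abs_mul, abs_mul, abs_mul, abs_of_pos (Real.exp_pos t),
        show |(-4 : ℝ)| = 4 by norm_num]
      have e0 : 0 ≤ Real.exp t := (Real.exp_pos t).le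
      calc 4 * Real.exp t * |W (2 * t)| * |h t| ≤ 4 * Real.exp t * 71 * B :=
          mul_le_mul (mul_le_mul_of_nonneg_left (hWbd _ h2t) (by positivity)) (hbd t ht)
            (abs_nonneg _) (by positivity)
        _ = 4 * 71 * B * Real.exp t := by ring
  have hI3 : IntegrableOn (fun t : ℝ => 2 * Real.exp (t / 2) * W t * h (t / 2)) (Iic 0) := by
    have hmaj : IntegrableOn (fun t : ℝ => 2 * 71 * B * Real.exp ((1 / 2) * t)) (Iic 0) :=
      (integrableOn_exp_mul_Iic (by norm_num : (0 : ℝ) < 1 / 2) 0).const_mul _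
    refine Integrable.mono' hmaj ?_ ?_
    · exact ((((continuous_const.mul (Real.continuous_exp.comp (continuous_id.div_const 2))).continuousOn).mul
        hWcont).mul hh2cont) |>.aestronglyMeasurable measurableSet_Iic
    · refine (ae_restrict_iff' measurableSet_Iic).2 (Eventually.of_forall fun t ht => ?_)
      have ht2 : t / 2 ≤ 0 := by simp only [mem_Iic] at ht; linarith
      rw [Real.norm_eq_abs, abs_mul, abs_mul, abs_mul, abs_of_pos (Real.exp_pos _), abs_two,
        show (1 : ℝ) / 2 * t = t / 2 by ring]
      calc 2 * Real.exp (t / 2) * |W t| * |h (t / 2)| ≤ 2 * Real.exp (t / 2) * 71 * B :=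
          mul_le_mul (mul_le_mul_of_nonneg_left (hWbd t ht) (by positivity)) (hbd _ ht2)
            (abs_nonneg _) (by positivity)
        _ = 2 * 71 * B * Real.exp (t / 2) := by ring
  -- fundamental theorem of calculus on `(−∞, 0]` for `φ`
  have hFTC := integral_Iic_of_hasDerivAt_of_tendsto hφcont hφde (hI2.add hI1) hφlim
  rw [integral_add hI2 hI1, one_mul] at hFTC
  -- the dilation: `∫ 4e^{u}W(2u)h(u) du = ∫ 2e^{t/2}W(t)h(t/2) dt`
  have hdil : (∫ t in Iic (0 : ℝ), -4 * Real.exp t * W (2 * t) * h t) =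
      -∫ t in Iic (0 : ℝ), 2 * Real.exp (t / 2) * W t * h (t / 2) := by
    have := integral_dilate_Iic (fun t : ℝ => 2 * Real.exp (t / 2) * W t * h (t / 2))
    have hfun : (fun u : ℝ => (fun t : ℝ => 2 * Real.exp (t / 2) * W t * h (t / 2)) (2 * u)) =
        fun u : ℝ => 2 * Real.exp u * W (2 * u) * h u := by
      funext u
      simp only [show (2 : ℝ) * u / 2 = u by ring]
    rw [hfun] at this
    have hneg : (fun t : ℝ => -4 * Real.exp t * W (2 * t) * h t) =
        fun t : ℝ => (-2) * (2 * Real.exp t * W (2 * t) * h t) := by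
      funext t; ring
    rw [hneg, integral_const_mul, this]
    ring
  -- assemble
  have hsplit : (∫ t in Iic (0 : ℝ), W t * (h' t - 2 * Real.exp (t / 2) * h (t / 2))) =
      (∫ t in Iic (0 : ℝ), W t * h' t) - ∫ t in Iic (0 : ℝ), 2 * Real.exp (t / 2) * W t * h (t / 2) := by
    rw [← integral_sub hI1 hI3]
    congr 1; funext t; ring
  rw [hsplit]
  linarith [hFTC, hdil]

/-- **The range of `L₀` on the normalised decaying class is annihilated by the adjoint mode**: if in
addition `h(0) = 0` and `h(t) → 0` at `−∞`, then `∫_{(−∞,0]} w₁ · L₀h = 0`. [folklore] -/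
theorem range_annihilated (W : ℝ → ℝ)
    (hW : W = fun t : ℝ => ∑' m : ℕ,
      (∏ i ∈ Finset.range m, ((-4 : ℝ) / (2 ^ (i + 1) - 1))) * Real.exp ((2 ^ m - 1) * t))
    {h h' : ℝ → ℝ} {B : ℝ} (hcont : ContinuousOn h (Iic 0))
    (hde : ∀ t : ℝ, t < 0 → HasDerivAt h (h' t) t) (hbd : ∀ t : ℝ, t ≤ 0 → |h t| ≤ B)
    (hint : IntegrableOn h' (Iic 0)) (hlim : Tendsto h atBot (𝓝 0)) (h0 : h 0 = 0) :
    ∫ t in Iic (0 : ℝ), W t * (h' t - 2 * Real.exp (t / 2) * h (t / 2)) = 0 := by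
  rw [adjoint_green W hW hcont hde hbd hint hlim, h0, mul_zero, sub_zero]

/-- **THE BORDERING DIRECTION IS NOT IN THE RANGE.**  There is no `h`, continuous and bounded on
`(−∞,0]`, differentiable on `t < 0` with integrable derivative, with `h(0) = 0` and `h → 0` at `−∞`, that
solves `L₀h = (1 + t/2)e^{t}` (`= ∂_sG(b₀,·)|_{s=2}`) on `t < 0`: otherwise Green's identity would give
`∫ w₁(1+t/2)e^{t} = 0`, contradicting transversality.  First-order reading: the time ratio `s` must move
with the drain parameter `δ = Λ⁻²`.
[cite: Tao2016AveragedNS, §1.2 (dyadic model); cell vocabulary (bordered linearisation of the scalar front equation of `DyadicScalarFronts` at the relay profile; programme R-lac)] -/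
theorem bordering_not_in_range {h : ℝ → ℝ} {B : ℝ} (hcont : ContinuousOn h (Iic 0))
    (hde : ∀ t : ℝ, t < 0 →
      HasDerivAt h (2 * Real.exp (t / 2) * h (t / 2) + (1 + t / 2) * Real.exp t) t)
    (hbd : ∀ t : ℝ, t ≤ 0 → |h t| ≤ B) (hlim : Tendsto h atBot (𝓝 0)) (h0 : h 0 = 0) : False := by
  set W : ℝ → ℝ := fun t : ℝ => ∑' m : ℕ,
      (∏ i ∈ Finset.range m, ((-4 : ℝ) / (2 ^ (i + 1) - 1))) * Real.exp ((2 ^ m - 1) * t) with hW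
  have hB : 0 ≤ B := (abs_nonneg _).trans (hbd 0 le_rfl)
  -- the derivative `h' = 2e^{t/2}h(t/2) + (1+t/2)e^{t}` is integrable on the half-line
  have hh2cont : ContinuousOn (fun t : ℝ => h (t / 2)) (Iic 0) :=
    hcont.comp (continuous_id.div_const 2).continuousOn
      (fun t ht => by simp only [mem_Iic] at ht ⊢; linarith)
  have hint1 : IntegrableOn (fun t : ℝ => 2 * Real.exp (t / 2) * h (t / 2)) (Iic 0) := by
    have hmaj : IntegrableOn (fun t : ℝ => 2 * B * Real.exp ((1 / 2) * t)) (Iic 0) :=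
      (integrableOn_exp_mul_Iic (by norm_num : (0 : ℝ) < 1 / 2) 0).const_mul _
    refine Integrable.mono' hmaj ?_ ?_
    · exact (((continuous_const.mul (Real.continuous_exp.comp (continuous_id.div_const 2))).continuousOn).mul
        hh2cont) |>.aestronglyMeasurable measurableSet_Iic
    · refine (ae_restrict_iff' measurableSet_Iic).2 (Eventually.of_forall fun t ht => ?_)
      have ht2 : t / 2 ≤ 0 := by simp only [mem_Iic] at ht; linarith
      rw [Real.norm_eq_abs, abs_mul, abs_mul, abs_of_pos (Real.exp_pos _), abs_two,
        show (1 : ℝ) / 2 * t = t / 2 by ring]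
      calc 2 * Real.exp (t / 2) * |h (t / 2)| ≤ 2 * Real.exp (t / 2) * B :=
          mul_le_mul_of_nonneg_left (hbd _ ht2) (by positivity)
        _ = 2 * B * Real.exp (t / 2) := by ring
  have hint : IntegrableOn (fun t : ℝ => 2 * Real.exp (t / 2) * h (t / 2) + (1 + t / 2) * Real.exp t)
      (Iic 0) := by
    have h1 := integrableOn_weight_exp_mul (k := 1) one_pos
    simp only [one_mul] at h1
    exact hint1.add h1
  have hG := range_annihilated W hW hcont hde hbd hint hlim h0
  have hfun : (fun t : ℝ => W t * (2 * Real.exp (t / 2) * h (t / 2) + (1 + t / 2) * Real.exp t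
      - 2 * Real.exp (t / 2) * h (t / 2))) = fun t : ℝ => W t * ((1 + t / 2) * Real.exp t) := by
    funext t; ring
  rw [hfun] at hG
  exact transversality_ne_zero hG

end WakeRatchetRelayGreen

end Summit.NavierStokesRegularity.NavierStokesRegularity.Theorems

end
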